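import Mathlib
import HarnessLib
import Summits.NavierStokesRegularity.NavierStokesRegularity.Theorems.UnthreadedRigidityDoorUnthreadedRigidityMixedPairQuadLawPolarised
import Summits.NavierStokesRegularity.NavierStokesRegularity.Theorems.UnthreadedRigidityDoorUnthreadedRigidityMixedPairHelmholtzNonneg

/-!
# Route `UnthreadedRigidityDoor`, item `UnthreadedRigidity` (W2, stmt-NavierStokesRegularity-27585) — LINE g11-2 «MIXED PAIR»:
# BOTH RUNGS FROM THREE FLOW-FREE SLICE LAWS — the jet dictionary (M-part) of O2a′ and S-H′(c<0) discharged

Prover file (engine-1 g73, DIRECTOR-NS dss_172; `--supports stmt-NavierStokesRegularity-27585 --as helper`; route-independent imports).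

After `…MixedPairWindowReduction` (g72) both rungs of LINE g11-2 rest on the three primed slice bridges O2a′ / O2b′ / S-H′ (classical solution
on `[t₀,T)`, pressure decay at `t₀`, one-sided second jet silent).  Their M-part is the same for all three and is a tree dictionary (ns-crc-p1 g8,
`…ThreadingJetsSlice`): the one-sided second jet at `t₀` IS the formal jet `fluxJetTwo (u t₀) (p t₀) x₀`
(`iteratedDerivWithin_two_threadingFlux_Ici_eq_fluxJetTwo`), the slice `u t₀` is smooth and divergence free, `p t₀` is smooth and solves
`Δp = −div((u·∇)u)` (`laplacian_pressure_eq_Ico`).  File `…MixedPairQuadLawPolarised` did this for O2b′ (plus the analytic alternative); this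
file does it for O2a′ and S-H′(c<0), so that the SLICE RUNG RESTS ON THREE FLOW-FREE STATEMENTS ABOUT PAIR DATA (explicit binders, no new `def`):

* OBLIQUE SLICE LAW (L-part of O2a, CARD §3–§4, OPEN): admissible OBLIQUE pair data `u₀ = pairShell H₁ H₂ a Q x₀` with `H₂` analytic on `(0,∞)`,
  a smooth divergence-free slice, a smooth decaying pressure slice with `Δp₀ = −div((u₀·∇)u₀)`: `fluxJetTwo u₀ p₀ x₀ ≡ 0 ⇒ IsNullProfile H₂`;
* EQUATORIAL SLICE LAW (L-part of O2b, CARD §3/§5, OPEN; file `…QuadLawPolarised`): linked equatorial non-coaxial analytic admissible pair data: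
  `fluxJetTwo u₀ p₀ x₀ ≡ 0 ⇒ P₂ ≡ 0` on `(0,∞)`;
* HELMHOLTZ SLICE LAW, `c < 0` (L-part of S-H, CARD §5 Bessel branch, OPEN): non-coaxial admissible pair data with `K₁ = cH₁`, `K₂ = 3cH₂`,
  `c < 0`: `fluxJetTwo u₀ p₀ x₀ ≡ 0 ⇒ IsNullProfile H₁ ∨ IsNullProfile H₂` (the branch `c ≥ 0` is the tree theorem
  `MixedPair.helmholtzPairDead_of_negative`, g72).

Results: `obliqueVirialRigidity_primed_of_sliceLaw` (O2a′ ⇐ oblique slice law), `obliqueVirialRigidity_of_sliceLaw` (O2a),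
`helmholtzPairDead_primed_of_sliceLaw` (S-H′ ⇐ Helmholtz slice law with `c < 0`), `helmholtzPairDead_of_sliceLaw` (S-H),
★ `mixedPairOrderTwoRigidity_of_sliceLaws` — the slice rung `MixedPairOrderTwoRigidity` of LINE g11-2 from the three slice laws (by
`mixedPairOrderTwoRigidity_of_sliceBridges`, `equatorialDichotomy_primed_of_sliceLaw`, `helmholtzPairDead_of_negative`).  (The window rung
`MixedPairWindowRigidity` is unconditional — `mixedPairWindowRigidity_holds`, file `…MixedPairWindowRigidityHolds` — and is not re-derived here.)

HONEST LABEL: rung bookkeeping about SPECIAL two-shell data; the three slice laws (explicit-field second-jet computations) remain OPEN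
hypotheses; `UnthreadedRigidity` (27585), W2 and NS regularity remain OPEN; nothing here is a statement about Navier–Stokes regularity.  0 kit.
-/

noncomputable section

-- the summit and its single sub-problem share the name (CONVENTIONS §1), as in every Theorems file
set_option linter.dupNamespace false

namespace Summit.NavierStokesRegularity.NavierStokesRegularity.Theorems.UnthreadedRigidity.MixedPair

open scoped Topology InnerProductSpace Laplacian
open Filter Set MeasureTheory Function
open Literature.Analysis.FluidPDE
open Summit.NavierStokesRegularity.NavierStokesRegularity.Theorems.UnthreadedRigidity.ProfileHorn (E3 threadingFlux IsSliceAxisymmetric)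
open Summit.NavierStokesRegularity.NavierStokesRegularity.Theorems.UnthreadedRigidity.VirialHorn (e det3 vortAmpL VirialAdmissible sepShellL)
open Summit.NavierStokesRegularity.NavierStokesRegularity.Theorems.UnthreadedRigidity.ThreadingJets (fluxJetTwo
  iteratedDerivWithin_two_threadingFlux_Ici_eq_fluxJetTwo laplacian_pressure_eq_Ico)

section SliceLaws

/-! The three FLOW-FREE slice laws, as section hypotheses (explicit binders). -/

variable
  (hObL : ∀ (H₁ H₂ : ℝ → ℝ) (a : E3) (Q : E3 →L[ℝ] E3) (x₀ : E3) (p₀ : E3 → ℝ),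
    PairAdmissible H₁ H₂ a Q → IsOblique a Q → AnalyticOnNhd ℝ H₂ (Set.Ioi 0) →
    ContDiff ℝ (⊤ : ℕ∞) (pairShell H₁ H₂ a Q x₀) → VectorCalculus.IsDivFree (pairShell H₁ H₂ a Q x₀) →
    ContDiff ℝ (⊤ : ℕ∞) p₀ →
    (∀ x : E3, (Δ p₀) x = -VectorCalculus.divergence (convect (pairShell H₁ H₂ a Q x₀) (pairShell H₁ H₂ a Q x₀)) x) →
    Tendsto p₀ (cocompact E3) (𝓝 0) →
    (∀ x : E3, fluxJetTwo (pairShell H₁ H₂ a Q x₀) p₀ x₀ x = 0) →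
    IsNullProfile H₂)
  (hEqL : ∀ (H₁ H₂ : ℝ → ℝ) (a : E3) (Q : E3 →L[ℝ] E3) (x₀ : E3) (p₀ : E3 → ℝ),
    PairAdmissible H₁ H₂ a Q → IsEquatorial a Q → ¬ IsCoaxial a Q → IsLinked H₁ H₂ →
    AnalyticOnNhd ℝ H₁ (Set.Ioi 0) → AnalyticOnNhd ℝ H₂ (Set.Ioi 0) →
    ContDiff ℝ (⊤ : ℕ∞) (pairShell H₁ H₂ a Q x₀) → VectorCalculus.IsDivFree (pairShell H₁ H₂ a Q x₀) →
    ContDiff ℝ (⊤ : ℕ∞) p₀ →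
    (∀ x : E3, (Δ p₀) x = -VectorCalculus.divergence (convect (pairShell H₁ H₂ a Q x₀) (pairShell H₁ H₂ a Q x₀)) x) →
    Tendsto p₀ (cocompact E3) (𝓝 0) →
    (∀ x : E3, fluxJetTwo (pairShell H₁ H₂ a Q x₀) p₀ x₀ x = 0) →
    ∀ r : ℝ, 0 < r → H₁ r * vortAmpL 2 (vortAmpL 2 H₂) r - 3 * H₂ r * vortAmpL 1 (vortAmpL 1 H₁) r
      - 2 * vortAmpL 1 H₁ r * vortAmpL 2 H₂ r = 0)
  (hHL : ∀ (H₁ H₂ : ℝ → ℝ) (a : E3) (Q : E3 →L[ℝ] E3) (x₀ : E3) (p₀ : E3 → ℝ),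
    PairAdmissible H₁ H₂ a Q → ¬ IsCoaxial a Q →
    (∃ c : ℝ, c < 0 ∧ ∀ r : ℝ, 0 < r → vortAmpL 1 H₁ r = c * H₁ r ∧ vortAmpL 2 H₂ r = 3 * c * H₂ r) →
    ContDiff ℝ (⊤ : ℕ∞) (pairShell H₁ H₂ a Q x₀) → VectorCalculus.IsDivFree (pairShell H₁ H₂ a Q x₀) →
    ContDiff ℝ (⊤ : ℕ∞) p₀ →
    (∀ x : E3, (Δ p₀) x = -VectorCalculus.divergence (convect (pairShell H₁ H₂ a Q x₀) (pairShell H₁ H₂ a Q x₀)) x) →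
    Tendsto p₀ (cocompact E3) (𝓝 0) →
    (∀ x : E3, fluxJetTwo (pairShell H₁ H₂ a Q x₀) p₀ x₀ x = 0) →
    IsNullProfile H₁ ∨ IsNullProfile H₂)

include hObL in
/-- ★ **O2a′ «OBLIQUE VIRIAL RIGIDITY» (pressure decay at `t₀` only — verbatim the section hypothesis `hOb` of `…MixedPairWindowReduction`)
FROM THE OBLIQUE SLICE LAW**: the jet dictionary of `…ThreadingJetsSlice` turns the one-sided second-jet silence of the classical solution into
`fluxJetTwo (u t₀) (p t₀) x₀ ≡ 0` for the smooth divergence-free slice and its smooth Poisson pressure. -/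
theorem obliqueVirialRigidity_primed_of_sliceLaw :
    ∀ (t₀ T : ℝ) (u : ℝ → E3 → E3) (p : ℝ → E3 → ℝ) (x₀ a : E3) (Q : E3 →L[ℝ] E3) (H₁ H₂ : ℝ → ℝ),
      t₀ < T → IsClassicalNSSolutionOn (Set.Ico t₀ T) 1 0 u p → Tendsto (p t₀) (cocompact E3) (𝓝 0) →
      (∀ x : E3, ContDiffWithinAt ℝ 2 (fun t => threadingFlux u x₀ t x) (Set.Ici t₀) t₀) →
      PairAdmissible H₁ H₂ a Q → IsOblique a Q → u t₀ = pairShell H₁ H₂ a Q x₀ → AnalyticOnNhd ℝ H₂ (Set.Ioi 0) →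
      (∀ x : E3, iteratedDerivWithin 2 (fun t => threadingFlux u x₀ t x) (Set.Ici t₀) t₀ = 0) → IsNullProfile H₂ := by
  intro t₀ T u p x₀ a Q H₁ H₂ hT h hp _hcd hadm hob hu0 hA2 hjet
  have ht₀ : t₀ ∈ Ico t₀ T := ⟨le_rfl, hT⟩
  have hsm : ContDiff ℝ (⊤ : ℕ∞) (pairShell H₁ H₂ a Q x₀) := by rw [← hu0]; exact h.contDiff_velocity ht₀
  have hdiv : VectorCalculus.IsDivFree (pairShell H₁ H₂ a Q x₀) := by rw [← hu0]; exact h.divFree t₀ ht₀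
  have hpoi : ∀ x : E3, (Δ (p t₀)) x =
      -VectorCalculus.divergence (convect (pairShell H₁ H₂ a Q x₀) (pairShell H₁ H₂ a Q x₀)) x := by
    intro x
    rw [← hu0]
    exact laplacian_pressure_eq_Ico h hT ht₀ x
  have hj : ∀ x : E3, fluxJetTwo (pairShell H₁ H₂ a Q x₀) (p t₀) x₀ x = 0 := by
    intro x
    rw [← hu0, ← iteratedDerivWithin_two_threadingFlux_Ici_eq_fluxJetTwo h hT]
    exact hjet x
  exact hObL H₁ H₂ a Q x₀ (p t₀) hadm hob hA2 hsm hdiv (h.contDiff_pressure ht₀) hpoi hp hj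

include hObL in
/-- O2a `ObliqueVirialRigidity` from the oblique slice law. -/
theorem obliqueVirialRigidity_of_sliceLaw : MixedPair.ObliqueVirialRigidity :=
  obliqueVirialRigidity_of_primed (obliqueVirialRigidity_primed_of_sliceLaw hObL)

include hHL in
/-- ★ **S-H′ «THE HELMHOLTZ PAIR IS NOT SILENT» (pressure decay at `t₀` only — verbatim the section hypothesis `hH` of
`…MixedPairWindowReduction`) FROM THE HELMHOLTZ SLICE LAW WITH `c < 0`**: the branch `c ≥ 0` is `helmholtzPairDead_of_negative` (regular
decaying profiles with `K = cH`, `c ≥ 0`, are null, g72), the branch `c < 0` is the slice law through the jet dictionary. -/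
theorem helmholtzPairDead_primed_of_sliceLaw :
    ∀ (t₀ T : ℝ) (u : ℝ → E3 → E3) (p : ℝ → E3 → ℝ) (x₀ a : E3) (Q : E3 →L[ℝ] E3) (H₁ H₂ : ℝ → ℝ),
      t₀ < T → IsClassicalNSSolutionOn (Set.Ico t₀ T) 1 0 u p → Tendsto (p t₀) (cocompact E3) (𝓝 0) →
      (∀ x : E3, ContDiffWithinAt ℝ 2 (fun t => threadingFlux u x₀ t x) (Set.Ici t₀) t₀) →
      PairAdmissible H₁ H₂ a Q → ¬ IsCoaxial a Q → u t₀ = pairShell H₁ H₂ a Q x₀ → IsHelmholtzLinked H₁ H₂ →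
      (∀ x : E3, iteratedDerivWithin 2 (fun t => threadingFlux u x₀ t x) (Set.Ici t₀) t₀ = 0) →
      IsNullProfile H₁ ∨ IsNullProfile H₂ := by
  refine helmholtzPairDead_of_negative ?_
  intro t₀ T u p x₀ a Q H₁ H₂ hT h hp _hcd hadm hnco hu0 hc hjet
  have ht₀ : t₀ ∈ Ico t₀ T := ⟨le_rfl, hT⟩
  have hsm : ContDiff ℝ (⊤ : ℕ∞) (pairShell H₁ H₂ a Q x₀) := by rw [← hu0]; exact h.contDiff_velocity ht₀
  have hdiv : VectorCalculus.IsDivFree (pairShell H₁ H₂ a Q x₀) := by rw [← hu0]; exact h.divFree t₀ ht₀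
  have hpoi : ∀ x : E3, (Δ (p t₀)) x =
      -VectorCalculus.divergence (convect (pairShell H₁ H₂ a Q x₀) (pairShell H₁ H₂ a Q x₀)) x := by
    intro x
    rw [← hu0]
    exact laplacian_pressure_eq_Ico h hT ht₀ x
  have hj : ∀ x : E3, fluxJetTwo (pairShell H₁ H₂ a Q x₀) (p t₀) x₀ x = 0 := by
    intro x
    rw [← hu0, ← iteratedDerivWithin_two_threadingFlux_Ici_eq_fluxJetTwo h hT]
    exact hjet x
  exact hHL H₁ H₂ a Q x₀ (p t₀) hadm hnco hc hsm hdiv (h.contDiff_pressure ht₀) hpoi hp hj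

include hHL in
/-- S-H `HelmholtzPairDead` from the Helmholtz slice law with `c < 0`. -/
theorem helmholtzPairDead_of_sliceLaw : MixedPair.HelmholtzPairDead :=
  helmholtzPairDead_of_primed (helmholtzPairDead_primed_of_sliceLaw hHL)

include hObL hEqL hHL in
/-- ★ **THE SLICE RUNG OF LINE g11-2 FROM THREE FLOW-FREE SLICE LAWS**: `MixedPairOrderTwoRigidity` ⇐ OBLIQUE ∧ EQUATORIAL ∧ HELMHOLTZ(c<0)
slice laws — every remaining hypothesis is an explicit-field statement about pair DATA at one instant (no flow, no window, no jet dictionary).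
(The WINDOW rung needs none of them any more: `mixedPairWindowRigidity_holds`, file `…MixedPairWindowRigidityHolds`; from the slice laws it
would follow by `mixedPairWindowRigidity_of_sliceBridges` in the same way.) -/
theorem mixedPairOrderTwoRigidity_of_sliceLaws : MixedPair.MixedPairOrderTwoRigidity :=
  mixedPairOrderTwoRigidity_of_sliceBridges (obliqueVirialRigidity_primed_of_sliceLaw hObL)
    (equatorialDichotomy_primed_of_sliceLaw hEqL) (helmholtzPairDead_primed_of_sliceLaw hHL)

end SliceLaws

end Summit.NavierStokesRegularity.NavierStokesRegularity.Theorems.UnthreadedRigidity.MixedPair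

end
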